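import Literature.NumberTheory.EllipticCurves.IwasawaEisensteinTwistChar
import Literature.NumberTheory.EllipticCurves.GeomPointsGaloisModule
import HarnessLib

/-!
# The dictionary hypotheses for the inverse twist `κ⁻ = κ.unitTwist (-1)` and for `M = E[n]`

Topic `NumberTheory/EllipticCurves` (sequel to `IwasawaEisensteinTwistChar`; cell `pub/bsd-print-x9`, blueprint
HOME/p2/S1-DISCRETE-CONTROL §1: discharging the standing hypotheses `hχker`, `hχU`, `hact` of the transport / readout files
`IwasawaEisensteinTwistedRepH1Transport{,Proofs}`, `ZpExtensionEisensteinAdicTower{IncReadoutProofs,ReadoutColimit}` for the data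
of D1's `eisensteinDVRSetting`: twist `κ⁻ = κ.unitTwist (-1)`, tower on `K_∞ = K_∞(κ)`, levels `E[p^k]`).  Theorems only.

* `eisensteinTwistChar_unitTwist_eq_one_of_mem_kerSubgroup` / `_layerSubgroup`: `χ_{κ.unitTwist u} = 1` on `ker κ` and on the
  open subgroup `κ⁻¹(p^J ℤ_p)`, `J = eisensteinLevel` (the unit twist does not move `K_∞` or the layers);
* `eisensteinTwist_torsionGaloisModule_apply`: for `M = E[n]` with its Galois action, D1's `eisensteinTwist` acts through the
  `TwistedBy (eisensteinTwistChar κ hm k) E[n]` action (`hact`).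

References: [Howard2004HeegnerKolyvagin] §2.2; [Washington1997] §13.1–§13.2.  BSD is not proved by any of this.
-/

noncomputable section

open Literature.NumberTheory.EllipticCurves Literature.NumberTheory.GaloisRepresentations Field
open IwasawaAlgebra IwasawaAlgebra.EisensteinCoeff IwasawaAlgebra.EisensteinCoeff.TwistedBy

universe u

namespace Literature.NumberTheory.EllipticCurves

namespace ZpExtension

variable {K : Type u} [Field K] {p : ℕ} [Fact p.Prime] (κ : ZpExtension K p) {m : ℕ} (hm : 1 ≤ m)
  (k : ℕ)

/-- `χ_{κ.unitTwist u} = 1` on `Gal(K̄/K_∞(κ)) = ker κ` (`ker (κ.unitTwist u) = ker κ`). [cite: Washington1997, §13.1–§13.2] -/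
theorem eisensteinTwistChar_unitTwist_eq_one_of_mem_kerSubgroup (u : ℤ_[p]ˣ) {σ : absoluteGaloisGroup K}
    (hσ : σ ∈ κ.kerSubgroup) : (κ.unitTwist u).eisensteinTwistChar hm k σ = 1 :=
  (κ.unitTwist u).eisensteinTwistChar_eq_one_of_mem_kerSubgroup hm k ((κ.kerSubgroup_unitTwist u).symm ▸ hσ)

/-- `χ_{κ.unitTwist u} = 1` on the open layer subgroup `κ⁻¹(p^J ℤ_p)` of `κ`, `J = eisensteinLevel hm k`
(`layerSubgroup (κ.unitTwist u) J = layerSubgroup κ J`). [cite: Washington1997, §13.1–§13.2] -/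
theorem eisensteinTwistChar_unitTwist_eq_one_of_mem_layerSubgroup (u : ℤ_[p]ˣ) {σ : absoluteGaloisGroup K}
    (hσ : σ ∈ κ.layerSubgroup (eisensteinLevel (p := p) hm k)) : (κ.unitTwist u).eisensteinTwistChar hm k σ = 1 :=
  (κ.unitTwist u).eisensteinTwistChar_eq_one_of_mem_layerSubgroup hm k ((κ.layerSubgroup_unitTwist u _).symm ▸ hσ)

/-- **`hact` for `M = E[n]`**: D1's twisted module `E[n] ⊗ A_{m,k}(χ_κ)` (`κ.eisensteinTwist (torsionGaloisModule n)`) acts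
through the `TwistedBy (eisensteinTwistChar κ hm k) E[n]` action of the cocycle files.
[cite: Howard2004HeegnerKolyvagin, §2.2 (T_𝔮 = T ⊗ S_𝔮 with the diagonal action)] -/
theorem eisensteinTwist_torsionGaloisModule_apply (W : WeierstrassCurve K) (n : ℤ) (σ : absoluteGaloisGroup K)
    (x : Twisted p m k (WeierstrassCurve.geomTorsion W n)) :
    κ.eisensteinTwist (W.torsionGaloisModule n) hm k σ x =
      (ofTwisted (κ.eisensteinTwistChar hm k) (WeierstrassCurve.geomTorsion W n)).symm
        (σ • ofTwisted (κ.eisensteinTwistChar hm k) (WeierstrassCurve.geomTorsion W n) x) :=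
  κ.eisensteinTwist_apply_eq_twistedBy_smul hm k (W.torsionGaloisModule n) (W.torsionGaloisModule_apply_apply n) σ x

end ZpExtension

end Literature.NumberTheory.EllipticCurves
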